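import Summits.HubbardSuperconductivity.HubbardSuperconductivity.Theorems.AnisotropyChordTransferFibre3FinMHoleConv

/-!
# Route `AnisotropyChord` / H0 rotor rung: FIN regime certificate at `L = 10` — kernel facts, part b

KERNEL FACTS (zero data): cells of the λ-cover of the a-priori window at `L = 10` pass the regime check in CONVOLUTION form
`FinCell.mholeCellOK3 10 a b` (`…Fibre3FinMHoleConv` / `…Fibre3FinConvCell`: layer-0/1 positivity, then either the cell is vacuous —
the anisotropy enclosure lies below `0` — or `‖Π⁰‖² > 0` and `hi(T⁺) ≤ lo(ε₁(1 − 5/V + 6/V²)/2)`, `T⁺ = 3λ − 6·Σ_x φ(x)Σ_y φ(y)f(y−x)² / ‖Π⁰‖²`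
by row dot products over the `V²` pairs), one `decide +kernel` each (`maxHeartbeats 400000` pre-budgeted). The cell list
(14 points, units of `D = 2^60`; designed with the prover's float mirror `scratch/fin_iv3.py`) is assembled in `…Fibre3FinMHoleTen`.
Prover seat `hubbard-h0-rotor-p3` g4; helper for stmt-HubbardSuperconductivity-23918 (piece A of rung 19089; `--supports`, helper class).
WHAT THIS IS NOT: nothing here proves superconductivity in the Hubbard model (rotor TARGET as worded stays FALSE, g15 verdict); kernel
facts for ONE hypothesis (regime clause) of ONE conditional reduction at one `L`. Tree imports only; no sorry, no `native_decide`.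
-/

set_option linter.dupNamespace false
set_option autoImplicit false

namespace Summit.HubbardSuperconductivity.HubbardSuperconductivity.Theorems.AnisotropyChord.Transfer.Fibre3

namespace FinCell

set_option maxHeartbeats 400000 in
/-- kernel fact: cell 4 of 13 at `L = 10`, `λ·2^60 ∈ [5765815768047000, 10342711385473456]`, passes the regime check (convolution form). [folklore] -/
theorem cell10_4 : mholeCellOK3 10 5765815768047000 10342711385473456 = true := by
  decide +kernel

set_option maxHeartbeats 400000 in
/-- kernel fact: cell 5 of 13 at `L = 10`, `λ·2^60 ∈ [10342711385473456, 14004227879414620]`, passes the regime check (convolution form). [folklore] -/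
theorem cell10_5 : mholeCellOK3 10 10342711385473456 14004227879414620 = true := by
  decide +kernel

set_option maxHeartbeats 400000 in
/-- kernel fact: cell 6 of 13 at `L = 10`, `λ·2^60 ∈ [14004227879414620, 16933441074567552]`, passes the regime check (convolution form). [folklore] -/
theorem cell10_6 : mholeCellOK3 10 14004227879414620 16933441074567552 = true := by
  decide +kernel

end FinCell

end Summit.HubbardSuperconductivity.HubbardSuperconductivity.Theorems.AnisotropyChord.Transfer.Fibre3
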